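import Summits.ABC.IUTFork.Joshi.ArchimedeanUntiltsJoshi
import Mathlib.FieldTheory.IsAlgClosed.Classification
import Mathlib.RingTheory.AlgebraicIndependent.TranscendenceBasis
import Mathlib.Analysis.Complex.Cardinality
import Mathlib.Analysis.Complex.Polynomial.Basic
import Mathlib.Analysis.SpecialFunctions.Pow.Real
import Mathlib.Analysis.SpecialFunctions.Log.Basic
import HarnessLib

/-!
# [J-II½] Prop. 2.3.1 read LITERALLY is false in kernel: a wild automorphism of `ℂ` from a rescaled transcendence basis
# (proof-only companion of `Joshi/ArchimedeanUntiltsJoshi.lean`; the ENGINE is generic)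

Proof-only companion file of the abc-iut cell, branch E «type Joshi's construction, test vs S» (rung LADDER-ABC:A2.E; seat
abc-iut-E-t60, typer-side reader of slot T-38's `Joshi/ArchimedeanUntiltsJoshi.lean`, p432383). SOURCE: K. Joshi,
*Construction of Arithmetic Teichmüller Spaces II½: Deformations of Number Fields*, arXiv:2305.10398**v12** (UNREFEREED; bib
`Joshi2023ATS2half`), Prop. 2.3.1 p.12 l.7–10 of the render `HOME/plan/repair/lit/renders/Joshi-arxiv-2305.10398-ATS2half/`:
«Proposition 2.3.1 (Ostrowski's Theorem). Any archimedean valuation on `ℂ` (in the above sense) is of the form `|−|^s_ℂ` for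
`0 < s ∈ ℝ`.» Slot T-38 typed this sentence twice: LITERALLY (`ATS2half.Prop231Literal`: the valuation IS `‖·‖^s`) and in the
reading of the classical theorem it names (`ATS2half.Prop231`: `‖ι(·)‖^s` for a field embedding `ι : ℂ → ℂ`), flagging (F1)
that the literal sentence is contradicted by `‖σ(·)‖` for a discontinuous automorphism `σ` of `ℂ` but attempting no refutation
(«not constructed in Mathlib»). **This file supplies the refutation in kernel** — no folklore about `Aut(ℂ)` is needed:

* §1 ENGINE (generic, reusable — it is also the engine of [J-I] Thm. 11.1.1's «uncountably many inequivalent complete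
  valuations», slot E-t25): for an algebraically closed field `K` of characteristic `0`, a transcendence basis `v : ι → K` over
  `ℚ` and non-zero rationals `c : ι → ℚ`, there is a field automorphism `σ : K ≃+* K` with `σ (v i) = c i · v i` for every `i`
  (`exists_ringEquiv_apply_eq_mul`): rescale the basis inside `ℚ[v] ≅ MvPolynomial ι ℚ` and extend through
  Mathlib's `IsAlgClosure.equivOfEquiv` (`K` is an algebraic closure of `ℚ[v]`, `IsAlgClosed.isAlgClosure_of_transcendence_basis`).
* §2 `ℂ` has a transcendence basis over `ℚ` with a point `b₀` (cardinality `#ℂ = 𝔠 > ℵ₀`), hence a WILD automorphism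
  `σ : ℂ ≃+* ℂ`, `σ b₀ = 2·b₀`, `b₀ ≠ 0` (`Complex.exists_ringEquiv_apply_eq_two_mul`).
* §3 `abs := ‖σ(·)‖` is an archimedean valued field structure on `ℂ` in Bourbaki's sense (slot T-37's `ATS2h.IsValuedField`,
  T-38's `ATS2half.IsArchimedeanAbs`) with `abs 2 = 2` (so `s = 1` is forced) and `abs b₀ = 2‖b₀‖ ≠ ‖b₀‖`: hence
  `not_prop231Literal : ¬ ATS2half.Prop231Literal`. The Ostrowski READING `ATS2half.Prop231` (with `ι := σ`) is untouched and
  remains the typed hypothesis of record; T-38's 3-line DERIVABLE gap `isArchimedeanAbs_powAbs` is closed on the way.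

FRAMING. This locates, in kernel, that ONE printed sentence read literally is false as a statement of standard mathematics
(the classical theorem is «up to a field embedding»); it is a faithfulness datum for the referee lane (E-ref), NOT a verdict on
Joshi's construction, which uses Prop. 2.3.1 only through Def. 2.3.2 / Prop. 2.4.3 (exponents `s`), both untouched. **No side is
taken** on [IUTchIII] Cor. 3.12, on Joshi's claims, or on Mochizuki's report on them; typed ≠ proved; no new claim, no
definition, no `def … : Prop` hypothesis, nothing of OUR frozen interface imported (E-PLAN R14). Standard axioms only; sorry-free.
-/

set_option autoImplicit false

noncomputable section

open Set

namespace Summit.ABC.IUTFork.Joshi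

/-! ## 1. ENGINE: rescaling a transcendence basis extends to a field automorphism -/

namespace TranscendenceRescaling

open MvPolynomial

variable {ι : Type*}

/-- **ENGINE.** For an algebraically closed field `K` of characteristic `0`, a transcendence basis `v : ι → K` of `K/ℚ` and non-zero
rationals `c`, some field automorphism `σ` of `K` rescales the basis: `σ (v i) = c i · v i` for all `i`. (`K` is an algebraic
closure of `ℚ[v] = Algebra.adjoin ℚ (range v) ≅ MvPolynomial ι ℚ`; the rescaling automorphism of `ℚ[v]` extends by
`IsAlgClosure.equivOfEquiv`.) [folklore] -/
theorem exists_ringEquiv_apply_eq_mul {K : Type*} [Field K] [IsAlgClosed K] [CharZero K] {v : ι → K}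
    (hv : IsTranscendenceBasis ℚ v) (c : ι → ℚ) (hc : ∀ i, c i ≠ 0) :
    ∃ σ : K ≃+* K, ∀ i, σ (v i) = algebraMap ℚ K (c i) * v i := by
  classical
  haveI : IsAlgClosure (Algebra.adjoin ℚ (Set.range v)) K := IsAlgClosed.isAlgClosure_of_transcendence_basis v hv
  -- the `ℚ`-algebra automorphism of `MvPolynomial ι ℚ` rescaling the variables, `X i ↦ c i · X i`, inverse `X i ↦ (c i)⁻¹ · X i`
  let ψ : MvPolynomial ι ℚ ≃ₐ[ℚ] MvPolynomial ι ℚ :=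
    AlgEquiv.ofAlgHom (aeval fun i => C (c i) * X i) (aeval fun i => C (c i)⁻¹ * X i)
      (by
        refine algHom_ext fun i => ?_
        simp only [AlgHom.coe_comp, Function.comp_apply, aeval_X, map_mul, aeval_C, algebraMap_eq, AlgHom.coe_id, id_eq]
        rw [← mul_assoc, ← C_mul, inv_mul_cancel₀ (hc i), C_1, one_mul])
      (by
        refine algHom_ext fun i => ?_
        simp only [AlgHom.coe_comp, Function.comp_apply, aeval_X, map_mul, aeval_C, algebraMap_eq, AlgHom.coe_id, id_eq]
        rw [← mul_assoc, ← C_mul, mul_inv_cancel₀ (hc i), C_1, one_mul])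
  have hψ : ∀ i, ψ (X i) = C (c i) * X i := fun i => aeval_X _ i
  let φ : Algebra.adjoin ℚ (Set.range v) ≃+* Algebra.adjoin ℚ (Set.range v) :=
    (hv.1.aevalEquiv.symm.trans (ψ.trans hv.1.aevalEquiv)).toRingEquiv
  refine ⟨IsAlgClosure.equivOfEquiv K K φ, fun i => ?_⟩
  have hmem : v i ∈ Algebra.adjoin ℚ (Set.range v) := Algebra.subset_adjoin (Set.mem_range_self i)
  have h2 : hv.1.aevalEquiv (X i) = ⟨v i, hmem⟩ := Subtype.ext (by simp)
  have h3 : hv.1.aevalEquiv.symm ⟨v i, hmem⟩ = X i := by rw [← h2, AlgEquiv.symm_apply_apply]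
  have h4 : ((φ ⟨v i, hmem⟩ : Algebra.adjoin ℚ (Set.range v)) : K) = algebraMap ℚ K (c i) * v i := by
    simp only [φ, AlgEquiv.coe_ringEquiv, AlgEquiv.trans_apply, h3, hψ, map_mul]
    rw [MulMemClass.coe_mul, AlgebraicIndependent.aevalEquiv_apply_coe, AlgebraicIndependent.aevalEquiv_apply_coe,
      aeval_C, aeval_X]
  -- `algebraMap (adjoin ℚ (range v)) K` is the inclusion, definitionally
  have h1 : IsAlgClosure.equivOfEquiv K K φ (v i) = ((φ ⟨v i, hmem⟩ : Algebra.adjoin ℚ (Set.range v)) : K) :=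
    IsAlgClosure.equivOfEquiv_algebraMap K K φ ⟨v i, hmem⟩
  rw [h1]
  exact h4

end TranscendenceRescaling

/-! ## 2. A wild automorphism of `ℂ` -/

open Cardinal in
/-- `ℂ` has a transcendence basis over `ℚ`, and it is non-empty (indeed of cardinality `𝔠`): `#ℂ = 𝔠 > ℵ₀ ≥ #ℚ`. [folklore] -/
theorem Complex.exists_isTranscendenceBasis_nonempty :
    ∃ s : Set ℂ, IsTranscendenceBasis ℚ ((↑) : s → ℂ) ∧ s.Nonempty := by
  haveI : FaithfulSMul ℚ ℂ := (faithfulSMul_iff_algebraMap_injective ℚ ℂ).2 (algebraMap ℚ ℂ).injective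
  obtain ⟨s, hs⟩ := exists_isTranscendenceBasis ℚ ℂ
  refine ⟨s, hs, ?_⟩
  have hcard : #ℂ = #s := IsAlgClosed.cardinal_eq_cardinal_transcendence_basis_of_aleph0_lt' ((↑) : s → ℂ) hs
    (by rw [Cardinal.mkRat]) (by rw [Cardinal.mk_complex]; exact Cardinal.aleph0_lt_continuum)
  by_contra he
  rw [Set.not_nonempty_iff_eq_empty] at he
  have h0 : #s = 0 := by rw [he]; exact Cardinal.mk_eq_zero _
  have : #ℂ ≠ 0 := Cardinal.mk_ne_zero ℂ
  exact this (hcard.trans h0)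

/-- **A WILD automorphism of `ℂ`**: a field automorphism `σ` and a point `b₀ ≠ 0` with `σ b₀ = 2·b₀` (so `σ` is neither the
identity nor complex conjugation, and `‖σ(·)‖ ≠ ‖·‖`). From the ENGINE with `c = 2` at one basis element and `1` elsewhere.
[folklore] -/
theorem Complex.exists_ringEquiv_apply_eq_two_mul : ∃ (σ : ℂ ≃+* ℂ) (b₀ : ℂ), b₀ ≠ 0 ∧ σ b₀ = 2 * b₀ := by
  classical
  obtain ⟨s, hs, b₀, hb₀⟩ := Complex.exists_isTranscendenceBasis_nonempty
  let i₀ : s := ⟨b₀, hb₀⟩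
  let c : s → ℚ := fun i => if i = i₀ then 2 else 1
  have hc : ∀ i, c i ≠ 0 := fun i => by by_cases h : i = i₀ <;> simp [c, h]
  obtain ⟨σ, hσ⟩ := TranscendenceRescaling.exists_ringEquiv_apply_eq_mul hs c hc
  refine ⟨σ, b₀, hs.1.ne_zero i₀, ?_⟩
  have h := hσ i₀
  simp only [c, if_pos rfl, map_ofNat] at h
  exact h

/-! ## 3. Prop. 2.3.1 read literally is false; the archimedean-ness gap of T-38 closed -/

namespace ATS2half

open Summit.ABC.IUTFork.Joshi.ATS2h (IsValuedField)

/-- Transport along a field automorphism: `‖σ(·)‖` is a Bourbaki valued-field structure on `ℂ` (constant `A = 2`, non-trivial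
at `2`). [folklore] -/
theorem isValuedField_norm_ringEquiv (σ : ℂ ≃+* ℂ) : IsValuedField (fun z : ℂ => ‖σ z‖) where
  nonneg x := norm_nonneg _
  eq_zero_iff x := by rw [norm_eq_zero, map_eq_zero_iff σ σ.injective]
  map_mul x y := by rw [map_mul, norm_mul]
  exists_const := by
    refine ⟨2, two_pos, fun x y => ?_⟩
    rw [map_add]
    calc ‖σ x + σ y‖ ≤ ‖σ x‖ + ‖σ y‖ := norm_add_le _ _
      _ ≤ max ‖σ x‖ ‖σ y‖ + max ‖σ x‖ ‖σ y‖ := add_le_add (le_max_left _ _) (le_max_right _ _)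
      _ = 2 * max ‖σ x‖ ‖σ y‖ := by ring
  nontrivial := ⟨2, two_ne_zero, by rw [map_ofNat]; norm_num⟩

/-- `‖σ(·)‖` is ARCHIMEDEAN in the sense of §2.3 (not ultrametric: `‖σ(1+1)‖ = 2 > 1`). [folklore] -/
theorem isArchimedeanAbs_norm_ringEquiv (σ : ℂ ≃+* ℂ) : IsArchimedeanAbs (fun z : ℂ => ‖σ z‖) := by
  refine ⟨isValuedField_norm_ringEquiv σ, fun h => ?_⟩
  have h1 := h 1 1
  dsimp only at h1
  rw [map_add, map_one, max_self, norm_one] at h1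
  norm_num at h1

/-- T-38's DERIVABLE gap (p.12 l.4–5 «`(ℂ, |−|_ℂ)` is an archimedean valued field», Def. 2.3.2): `(ℂ, |−|^s_ℂ)`, `s > 0`, is
archimedean in the sense of §2.3 — Bourbaki valued (T-38's `isValuedField_powAbs`) and not ultrametric (`|1+1|^s = 2^s > 1`).
[folklore] -/
theorem isArchimedeanAbs_powAbs {s : ℝ} (hs : 0 < s) : IsArchimedeanAbs (powAbs s) := by
  refine ⟨isValuedField_powAbs hs, fun h => ?_⟩
  have h1 := h 1 1
  simp only [powAbs_apply, norm_one, Real.one_rpow, max_self] at h1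
  have h2 : ‖(1 : ℂ) + 1‖ = 2 := by norm_num
  rw [h2] at h1
  exact absurd h1 (not_le.2 (Real.one_lt_rpow one_lt_two hs))

/-- From `2^t = 2` (real exponent) conclude `t = 1`. [folklore] -/
theorem eq_one_of_two_rpow_eq_two {t : ℝ} (h : (2 : ℝ) ^ t = 2) : t = 1 := by
  have hl := congrArg Real.log h
  rw [Real.log_rpow two_pos] at hl
  have hlog : Real.log 2 ≠ 0 := (Real.log_pos one_lt_two).ne'
  field_simp at hl
  linarith [hl]

/-- **[J-II½] Prop. 2.3.1 READ LITERALLY (`Prop231Literal`: «any archimedean valuation on `ℂ` IS `|−|^s_ℂ`») is FALSE**: for the wild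
automorphism `σ` of §2, `abs := ‖σ(·)‖` is an archimedean Bourbaki valuation with `abs 2 = 2` — forcing `s = 1` — and
`abs b₀ = ‖2 b₀‖ = 2‖b₀‖ ≠ ‖b₀‖`. The Ostrowski READING `Prop231` (embedding `ι := σ`) is not refuted and stays the hypothesis of
record; T-38 flagged exactly this as (F1). Located standard mathematics; no side taken on any author.
[claim: Joshi2023ATS2half, status: disputed] -/
theorem not_prop231Literal : ¬ Prop231Literal := by
  intro h
  obtain ⟨σ, b₀, hb₀, hσ⟩ := Complex.exists_ringEquiv_apply_eq_two_mul
  obtain ⟨t, _ht, he⟩ := h (fun z => ‖σ z‖) (isArchimedeanAbs_norm_ringEquiv σ)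
  have h2 : (2 : ℝ) ^ t = 2 := by
    have := congrFun he 2
    simp only [powAbs_apply, map_ofNat] at this
    have hn : ‖(2 : ℂ)‖ = 2 := by norm_num
    rw [hn] at this
    exact this.symm
  have ht1 : t = 1 := eq_one_of_two_rpow_eq_two h2
  have hb := congrFun he b₀
  simp only [powAbs_apply, hσ, ht1, Real.rpow_one, norm_mul] at hb
  have hn : ‖(2 : ℂ)‖ = 2 := by norm_num
  rw [hn] at hb
  have : ‖b₀‖ = 0 := by linarith
  exact hb₀ (norm_eq_zero.1 this)

/-- Hence the two typings of Prop. 2.3.1 are NOT equivalent in kernel: the literal one is false, so `prop231_of_literal` has no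
input; whether the Ostrowski reading holds is Mathlib-independent of this file. [claim: Joshi2023ATS2half, status: disputed] -/
theorem prop231Literal_iff_false : Prop231Literal ↔ False := ⟨not_prop231Literal, False.elim⟩

end ATS2half

end Summit.ABC.IUTFork.Joshi

end
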